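import Summits.KontsevichZagierPeriods.KontsevichZagierPeriods.Theorems.RootDecompRationalCubeDichotomyArctanFibreP6

/-!
# Arctan-fibre calculus for `RationalCubePiKernelSingle` (route `RootDecompRationalCubeDichotomy`, crux stmt-KontsevichZagierPeriods-26322) at `m = 2` · part 7/9

Cell `decomp-kz`, lens 2 (decomp-kz-lens-2 g7): the GENERIC (arctan-fibre) side of the first open rung `m = 2` of
`RationalCubePiKernelSingle` decided INSIDE the Kontsevich–Zagier calculus with `N = 0`, by rules 1+2 only: fibred Möbius
charts `x ↦ x(q+r)/(q+rx)` (`MoebiusData.rel`), the TANGENT-ADDITION chart `x ↦ x(1−p)/(1−px²)` = the group law of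
`tan` as a move (`TanData.tan_add`), Serret's base involution `y ↦ (1−y)/(1+y)` (`rel_serret`), one moving-centre
dissection with null surgery (§8), odd-symmetry vanishing (§7b).  Decided census classes: `π·log 2` (`pilog2_rel`,
census pair #33), Catalan (`catalan_rel`, #32), dilogarithm classes `dilogA_rel` (#28), `dilogB_rel` (#30),
`dilogC_rel` (#24), seven moment relations; §9 the LITERAL binder instances of `RationalCubePiKernelSingle` at
`m = 2`, `N = 0` (the route decl is not referenced by name, so these modules do not import the route file);
§10 six UNIFORM CLASSES `single_classSwap/Reflect/Halve/Moebius/Serret/TanAdd`.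

Source: `HOME/decomp-kz-lens-2/g7/ArctanFibreCalculus.lean` sha256 964497cf335d1c59 (2144 l; critic decomp-kz-crit-1 g2
CLEARED 2026-08-30T09:13:02Z incl. transcription numerics, std axioms), split into 9 modules by the landing seat
decomp-kz-census-1 g7 (contexts re-opened per part; generic docstrings added where the source had none).
No `sorry`; standard axioms.  References: [cite: KontsevichZagier2001, §1.2]; J.-A. Serret (1844).
-/

noncomputable section

open Set MeasureTheory MvPolynomial
open Literature.ModelTheory.ExponentialFields (IsSemialgebraic)
open Literature.NumberTheory.Transcendental
open Literature.NumberTheory.Transcendental.KZ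
open Literature.NumberTheory.Transcendental.KZ.RFun
open Summit.KontsevichZagierPeriods.KontsevichZagierPeriods.Theorems

namespace Summit.KontsevichZagierPeriods.RootDecompRationalCubeDichotomy.ArctanFibre

-- PRIVATE copy (landed twin elsewhere / dedup.landed): cube_succ_eq_band, mem_cube_two, mem_cube_one_iff, vec_mem_cube_two, snoc_two_zero, snoc_two_one, init_apply_zero, vec_eta, vec_zero, vec_one, rel_constMul
/-- `[0,1]^{M+1}` is the band over `[0,1]^M` with edges `0` and `1`. -/
private theorem cube_succ_eq_band (M : ℕ) :
    KZ.cube (M + 1) = KZlog.band (KZ.cube M) (fun _ => (0 : ℝ)) (fun _ => 1) := by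
  rw [KZ.cube_succ_eq]; rfl

/-- `mem_cube_two`: auxiliary theorem of the arctan-fibre calculus for `RationalCubePiKernelSingle` (stmt-26322) — see the module docstring; verbatim from the lens file. -/
private theorem mem_cube_two {z : Fin 2 → ℝ} (hz : z ∈ KZ.cube 2) :
    (0 ≤ z 0 ∧ z 0 ≤ 1) ∧ (0 ≤ z 1 ∧ z 1 ≤ 1) := ⟨hz 0, hz 1⟩

/-- `mem_cube_one_iff`: auxiliary theorem of the arctan-fibre calculus for `RationalCubePiKernelSingle` (stmt-26322) — see the module docstring; verbatim from the lens file. -/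
private theorem mem_cube_one_iff {y : Fin 1 → ℝ} : y ∈ KZ.cube 1 ↔ 0 ≤ y 0 ∧ y 0 ≤ 1 := by
  rw [KZ.mem_cube]
  exact ⟨fun h => h 0, fun h i => by fin_cases i; exact h⟩

/-- Points of the square given by two coordinates in `[0,1]`. -/
private theorem vec_mem_cube_two {a b : ℝ} (ha : 0 ≤ a ∧ a ≤ 1) (hb : 0 ≤ b ∧ b ≤ 1) :
    (![a, b] : Fin 2 → ℝ) ∈ KZ.cube 2 := by
  intro i; fin_cases i
  · exact ha
  · exact hb

/-- `snoc_two_zero`: auxiliary theorem of the arctan-fibre calculus for `RationalCubePiKernelSingle` (stmt-26322) — see the module docstring; verbatim from the lens file. -/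
@[simp] private theorem snoc_two_zero (y : Fin 1 → ℝ) (s : ℝ) : (Fin.snoc y s : Fin 2 → ℝ) 0 = y 0 := rfl

/-- `snoc_two_one`: auxiliary theorem of the arctan-fibre calculus for `RationalCubePiKernelSingle` (stmt-26322) — see the module docstring; verbatim from the lens file. -/
@[simp] private theorem snoc_two_one (y : Fin 1 → ℝ) (s : ℝ) : (Fin.snoc y s : Fin 2 → ℝ) 1 = s := rfl

/-- `init_apply_zero`: auxiliary theorem of the arctan-fibre calculus for `RationalCubePiKernelSingle` (stmt-26322) — see the module docstring; verbatim from the lens file. -/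
@[simp] private theorem init_apply_zero (z : Fin 2 → ℝ) : Fin.init z 0 = z 0 := rfl

/-- `z = (z 0, z 1)`. -/
private theorem vec_eta (z : Fin 2 → ℝ) : z = ![z 0, z 1] := by
  funext i; fin_cases i <;> rfl

/-- `vec_zero`: auxiliary theorem of the arctan-fibre calculus for `RationalCubePiKernelSingle` (stmt-26322) — see the module docstring; verbatim from the lens file. -/
@[simp] private theorem vec_zero (a b : ℝ) : (![a, b] : Fin 2 → ℝ) 0 = a := rfl

/-- `vec_one`: auxiliary theorem of the arctan-fibre calculus for `RationalCubePiKernelSingle` (stmt-26322) — see the module docstring; verbatim from the lens file. -/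
@[simp] private theorem vec_one (a b : ℝ) : (![a, b] : Fin 2 → ℝ) 1 = b := rfl

/-- Natural-number multiples: `[c·T] ≡ c • [T]`. -/
private theorem rel_constMul (c : ℕ) (T : RFun 2) :
    KZ.of (((const (c : ℚ)).mul T)).rep - c • KZ.of T.rep ∈ KZ.relations :=
  SoloBlind.of_sub_nsmul_mem_relations c rfl fun x _ => by
    simp only [rep_integrand, fn_mul, fn_const, Rat.cast_natCast]

section Moments

/-- `[□, x/G_a] ≡ [□, 1/G_b]` (both `= G/3`): `2[x/G_a] = [G_a] = 2[G_b]`. -/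
theorem mGax_cGb : KZ.of mGax.rep - KZ.of cGb.rep ∈ KZ.relations := by
  have hE : KZ.of ((const ((2 : ℕ) : ℚ)).mul mGax).rep - KZ.of (cGa.sub mGaodd).rep ∈ KZ.relations :=
    rel_of_eqOn fun z hz => by
      obtain ⟨⟨hy0, hy1⟩, hx0, hx1⟩ := mem_cube_two hz
      have hy1' : (0 : ℝ) ≤ 1 - z 0 := by linarith
      have hx1' : (0 : ℝ) ≤ 1 - z 1 := by linarith
      rw [fn_mul, fn_const, fn_sub hz, cGa_fn, mGaodd_fn, mGax_fn, Rat.cast_natCast, Nat.cast_ofNat]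
      field_simp (disch := first | assumption | positivity | (with_unfolding_all (apply ne_of_gt; nlinarith [mul_nonneg hx0 hy0, mul_nonneg hx0 hx1', mul_nonneg hy0 hy1', mul_nonneg hx1' hy1', sq_nonneg (2 * z 1 - 1), sq_nonneg (2 * z 0 - 1)])))
      ring
  have h2 : 2 • (KZ.of mGax.rep - KZ.of cGb.rep) ∈ KZ.relations := by
    convert add_mem (sub_mem (add_mem (sub_mem hE (rel_constMul 2 mGax)) (rel_sub cGa mGaodd))
      mGaodd_rel) catalan_rel using 1
    simp only [smul_sub]; abel
  exact SoloBlind.mem_relations_of_nsmul_mem (k := 2) two_ne_zero h2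

end Moments

/-! ## 8. The dissection chain for `[A]` (`= 3π log 2/8`)

`A = 1/Q_A`, `Q_A = (x+y)² + (1−x)²`, is cut along `x = f(y) = (1−y)/2` (the foot of the moving root
`x + y = 0` reflected into the square). The piece `x ≥ f(y)` is carried onto the whole square by the fibred
chart `u = (2x+y−1)/(x+y)` (giving `[□, 1/((1+y)(1+(1−u)²))] = reflect₁ p₀`), the piece `x ≤ f(y)` — over the
half-open base `0 ≤ y < 1`, which differs from the closed one by a null face — by the fibred chart
`u = x(1+y)²/((1−y)(1+y²−(1−y)x))` (giving `J₁'`). Hence `[A] ≡ [p₀] + [J₁']`, and with §5,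
`2[A] ≡ 3[p₀] ≡ 6[B]`, i.e. `[A] ≡ 3[B]` after dividing by `2` in `P_KZ^eff`. -/

section Dissection

/-- The cut `f(y) = (1 − y)/2`. -/
def fA : (Fin 1 → ℝ) → ℝ := fun w => (1 - w 0) / 2

/-- `fA_apply`: auxiliary theorem of the arctan-fibre calculus for `RationalCubePiKernelSingle` (stmt-26322) — see the module docstring; verbatim from the lens file. -/
@[simp] theorem fA_apply (w : Fin 1 → ℝ) : fA w = (1 - w 0) / 2 := rfl

/-- `fA_sa`: auxiliary theorem of the arctan-fibre calculus for `RationalCubePiKernelSingle` (stmt-26322) — see the module docstring; verbatim from the lens file. -/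
theorem fA_sa {s : Set (Fin 1 → ℝ)} (hs : IsSemialgebraic ℚ s) : IsSemialgebraicFunOn ℚ s fA :=
  (isSemialgebraicFunOn_aeval_div_aeval hs (1 - X 0) 2 (fun w _ => by simp)).congr
    (fun _ _ => by simp)

/-- `zero_sa`: auxiliary theorem of the arctan-fibre calculus for `RationalCubePiKernelSingle` (stmt-26322) — see the module docstring; verbatim from the lens file. -/
theorem zero_sa {s : Set (Fin 1 → ℝ)} (hs : IsSemialgebraic ℚ s) :
    IsSemialgebraicFunOn ℚ s (fun _ => (0 : ℝ)) :=
  (isSemialgebraicFunOn_aeval hs 0).congr (fun w _ => by simp)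

/-- `one_sa`: auxiliary theorem of the arctan-fibre calculus for `RationalCubePiKernelSingle` (stmt-26322) — see the module docstring; verbatim from the lens file. -/
theorem one_sa {s : Set (Fin 1 → ℝ)} (hs : IsSemialgebraic ℚ s) :
    IsSemialgebraicFunOn ℚ s (fun _ => (1 : ℝ)) :=
  (isSemialgebraicFunOn_aeval hs 1).congr (fun w _ => by simp)

/-- The half-open base `0 ≤ y < 1` (written as an intersection of polynomial sign conditions). -/
def Gopen : Set (Fin 1 → ℝ) :=
  {w | 0 ≤ aeval w (X 0 : MvPolynomial (Fin 1) ℚ)} ∩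
    {w | aeval w (X 0 : MvPolynomial (Fin 1) ℚ) < aeval w (1 : MvPolynomial (Fin 1) ℚ)}

/-- `Gopen_sa`: auxiliary theorem of the arctan-fibre calculus for `RationalCubePiKernelSingle` (stmt-26322) — see the module docstring; verbatim from the lens file. -/
theorem Gopen_sa : IsSemialgebraic ℚ Gopen :=
  (Literature.ModelTheory.ExponentialFields.isSemialgebraic_setOf_eval_nonneg _).inter
    (Literature.ModelTheory.ExponentialFields.isSemialgebraic_setOf_eval_lt _ _)

/-- `mem_Gopen_iff`: auxiliary theorem of the arctan-fibre calculus for `RationalCubePiKernelSingle` (stmt-26322) — see the module docstring; verbatim from the lens file. -/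
theorem mem_Gopen_iff {w : Fin 1 → ℝ} : w ∈ Gopen ↔ 0 ≤ w 0 ∧ w 0 < 1 := by
  simp [Gopen]

/-- `Gopen_subset_cube`: auxiliary theorem of the arctan-fibre calculus for `RationalCubePiKernelSingle` (stmt-26322) — see the module docstring; verbatim from the lens file. -/
theorem Gopen_subset_cube : Gopen ⊆ KZ.cube 1 := fun w hw => by
  obtain ⟨h0, h1⟩ := mem_Gopen_iff.mp hw
  exact mem_cube_one_iff.mpr ⟨h0, h1.le⟩

/-- `last_one`: auxiliary theorem of the arctan-fibre calculus for `RationalCubePiKernelSingle` (stmt-26322) — see the module docstring; verbatim from the lens file. -/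
@[simp] theorem last_one : Fin.last 1 = 1 := rfl

/-- The piece `0 ≤ x ≤ f(y)` over the closed base. -/
def bandLo : Set (Fin 2 → ℝ) := KZlog.band (KZ.cube 1) (fun _ => (0 : ℝ)) fA
/-- The piece `f(y) ≤ x ≤ 1` over the closed base. -/
def bandHi : Set (Fin 2 → ℝ) := KZlog.band (KZ.cube 1) fA (fun _ => (1 : ℝ))
/-- The piece `0 ≤ x ≤ f(y)` over the half-open base. -/
def bandLoO : Set (Fin 2 → ℝ) := KZlog.band Gopen (fun _ => (0 : ℝ)) fA
/-- The square over the half-open base. -/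
def bandBO : Set (Fin 2 → ℝ) := KZlog.band Gopen (fun _ => (0 : ℝ)) (fun _ => (1 : ℝ))

/-- `mem_bandLo`: auxiliary theorem of the arctan-fibre calculus for `RationalCubePiKernelSingle` (stmt-26322) — see the module docstring; verbatim from the lens file. -/
theorem mem_bandLo {z : Fin 2 → ℝ} :
    z ∈ bandLo ↔ (0 ≤ z 0 ∧ z 0 ≤ 1) ∧ 0 ≤ z 1 ∧ z 1 ≤ (1 - z 0) / 2 := by
  simp only [bandLo, KZlog.mem_band, mem_cube_one_iff, init_apply_zero, fA_apply, last_one]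

/-- `mem_bandHi`: auxiliary theorem of the arctan-fibre calculus for `RationalCubePiKernelSingle` (stmt-26322) — see the module docstring; verbatim from the lens file. -/
theorem mem_bandHi {z : Fin 2 → ℝ} :
    z ∈ bandHi ↔ (0 ≤ z 0 ∧ z 0 ≤ 1) ∧ (1 - z 0) / 2 ≤ z 1 ∧ z 1 ≤ 1 := by
  simp only [bandHi, KZlog.mem_band, mem_cube_one_iff, init_apply_zero, fA_apply, last_one]

/-- `mem_bandLoO`: auxiliary theorem of the arctan-fibre calculus for `RationalCubePiKernelSingle` (stmt-26322) — see the module docstring; verbatim from the lens file. -/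
theorem mem_bandLoO {z : Fin 2 → ℝ} :
    z ∈ bandLoO ↔ (0 ≤ z 0 ∧ z 0 < 1) ∧ 0 ≤ z 1 ∧ z 1 ≤ (1 - z 0) / 2 := by
  simp only [bandLoO, KZlog.mem_band, mem_Gopen_iff, init_apply_zero, fA_apply, last_one]

/-- `mem_bandBO`: auxiliary theorem of the arctan-fibre calculus for `RationalCubePiKernelSingle` (stmt-26322) — see the module docstring; verbatim from the lens file. -/
theorem mem_bandBO {z : Fin 2 → ℝ} :
    z ∈ bandBO ↔ (0 ≤ z 0 ∧ z 0 < 1) ∧ 0 ≤ z 1 ∧ z 1 ≤ 1 := by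
  simp only [bandBO, KZlog.mem_band, mem_Gopen_iff, init_apply_zero, last_one]

/-- `bandLo_sa`: auxiliary theorem of the arctan-fibre calculus for `RationalCubePiKernelSingle` (stmt-26322) — see the module docstring; verbatim from the lens file. -/
theorem bandLo_sa : IsSemialgebraic ℚ bandLo :=
  KZlog.isSemialgebraic_band (zero_sa KZ.isSemialgebraic_cube) (fA_sa KZ.isSemialgebraic_cube)
/-- `bandHi_sa`: auxiliary theorem of the arctan-fibre calculus for `RationalCubePiKernelSingle` (stmt-26322) — see the module docstring; verbatim from the lens file. -/
theorem bandHi_sa : IsSemialgebraic ℚ bandHi :=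
  KZlog.isSemialgebraic_band (fA_sa KZ.isSemialgebraic_cube) (one_sa KZ.isSemialgebraic_cube)
/-- `bandLoO_sa`: auxiliary theorem of the arctan-fibre calculus for `RationalCubePiKernelSingle` (stmt-26322) — see the module docstring; verbatim from the lens file. -/
theorem bandLoO_sa : IsSemialgebraic ℚ bandLoO :=
  KZlog.isSemialgebraic_band (zero_sa Gopen_sa) (fA_sa Gopen_sa)
/-- `bandBO_sa`: auxiliary theorem of the arctan-fibre calculus for `RationalCubePiKernelSingle` (stmt-26322) — see the module docstring; verbatim from the lens file. -/
theorem bandBO_sa : IsSemialgebraic ℚ bandBO :=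
  KZlog.isSemialgebraic_band (zero_sa Gopen_sa) (one_sa Gopen_sa)

/-- `bandLo_sub`: auxiliary theorem of the arctan-fibre calculus for `RationalCubePiKernelSingle` (stmt-26322) — see the module docstring; verbatim from the lens file. -/
theorem bandLo_sub : bandLo ⊆ KZ.cube 2 := fun z hz => by
  obtain ⟨⟨hy0, hy1⟩, hx0, hx1⟩ := mem_bandLo.mp hz
  rw [vec_eta z]
  exact vec_mem_cube_two ⟨hy0, hy1⟩ ⟨hx0, by linarith⟩
/-- `bandHi_sub`: auxiliary theorem of the arctan-fibre calculus for `RationalCubePiKernelSingle` (stmt-26322) — see the module docstring; verbatim from the lens file. -/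
theorem bandHi_sub : bandHi ⊆ KZ.cube 2 := fun z hz => by
  obtain ⟨⟨hy0, hy1⟩, hx0, hx1⟩ := mem_bandHi.mp hz
  rw [vec_eta z]
  exact vec_mem_cube_two ⟨hy0, hy1⟩ ⟨by linarith, hx1⟩
/-- `bandLoO_sub_bandLo`: auxiliary theorem of the arctan-fibre calculus for `RationalCubePiKernelSingle` (stmt-26322) — see the module docstring; verbatim from the lens file. -/
theorem bandLoO_sub_bandLo : bandLoO ⊆ bandLo := fun z hz => by
  obtain ⟨⟨hy0, hy1⟩, hx0, hx1⟩ := mem_bandLoO.mp hz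
  exact mem_bandLo.mpr ⟨⟨hy0, hy1.le⟩, hx0, hx1⟩
/-- `bandLoO_sub`: auxiliary theorem of the arctan-fibre calculus for `RationalCubePiKernelSingle` (stmt-26322) — see the module docstring; verbatim from the lens file. -/
theorem bandLoO_sub : bandLoO ⊆ KZ.cube 2 := bandLoO_sub_bandLo.trans bandLo_sub
/-- `bandBO_sub`: auxiliary theorem of the arctan-fibre calculus for `RationalCubePiKernelSingle` (stmt-26322) — see the module docstring; verbatim from the lens file. -/
theorem bandBO_sub : bandBO ⊆ KZ.cube 2 := fun z hz => by
  obtain ⟨⟨hy0, hy1⟩, hx0, hx1⟩ := mem_bandBO.mp hz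
  rw [vec_eta z]
  exact vec_mem_cube_two ⟨hy0, hy1.le⟩ ⟨hx0, hx1⟩

/-- `A` restricted to the piece `x ≤ f(y)`. -/
def ALo : KZ.IntegralRep 2 := cA.rep.restrict bandLo bandLo_sa bandLo_sub
/-- `A` restricted to the piece `x ≥ f(y)`. -/
def AHi : KZ.IntegralRep 2 := cA.rep.restrict bandHi bandHi_sa bandHi_sub
/-- `A` restricted to the piece `x ≤ f(y)`, half-open base. -/
def ALoO : KZ.IntegralRep 2 := cA.rep.restrict bandLoO bandLoO_sa bandLoO_sub
/-- `J₁'` restricted to the square over the half-open base. -/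
def BO : KZ.IntegralRep 2 := J1p.rep.restrict bandBO bandBO_sa bandBO_sub

/-- The face `y = c` of the square is null. -/
private theorem volume_setOf_zero_eq (c : ℝ) : volume {z : Fin 2 → ℝ | z 0 = c} = 0 := by
  rw [MeasureTheory.volume_pi]
  exact MeasureTheory.Measure.pi_hyperplane (fun _ : Fin 2 => (volume : Measure ℝ)) 0 c

/-- `π4`: `[A] ≡ [A_lo] + [A_hi]` (rule 1a; the overlap is the graph of `f`). -/
theorem cA_split : KZ.of cA.rep - KZ.of ALo - KZ.of AHi ∈ KZ.relations := by
  refine KZ.domainAddRel_subset_relations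
    ⟨2, cA.rep, ALo, AHi, ?_, ?_, fun _ _ => rfl, fun _ _ => rfl, rfl⟩
  · show KZ.cube 2 = bandLo ∪ bandHi
    ext z
    rw [mem_union, mem_bandLo, mem_bandHi]
    constructor
    · intro hz
      obtain ⟨⟨hy0, hy1⟩, hx0, hx1⟩ := mem_cube_two hz
      by_cases h : z 1 ≤ (1 - z 0) / 2
      · exact Or.inl ⟨⟨hy0, hy1⟩, hx0, h⟩
      · exact Or.inr ⟨⟨hy0, hy1⟩, (not_le.mp h).le, hx1⟩
    · rintro (⟨⟨hy0, hy1⟩, hx0, hx1⟩ | ⟨⟨hy0, hy1⟩, hx0, hx1⟩)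
      · rw [vec_eta z]; exact vec_mem_cube_two ⟨hy0, hy1⟩ ⟨hx0, by linarith⟩
      · rw [vec_eta z]; exact vec_mem_cube_two ⟨hy0, hy1⟩ ⟨by linarith, hx1⟩
  · show volume (bandLo ∩ bandHi) = 0
    refine measure_mono_null (fun z hz => ?_) (KZ.volume_graph_eq_zero (fA_sa KZ.isSemialgebraic_cube))
    obtain ⟨h1, h2⟩ := hz
    obtain ⟨⟨hy0, hy1⟩, -, hx1⟩ := mem_bandLo.mp h1
    obtain ⟨-, hx0, -⟩ := mem_bandHi.mp h2
    refine ⟨mem_cube_one_iff.mpr ⟨hy0, hy1⟩, ?_⟩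
    show z 1 = (1 - z 0) / 2
    exact le_antisymm hx1 hx0

/-- The chart of the upper piece: `u = (2x + y − 1)/(x + y)`. -/
def ψ5 : (Fin 2 → ℝ) → ℝ := fun w =>
  aeval w (2 * X 1 + X 0 - 1 : MvPolynomial (Fin 2) ℚ) / aeval w (X 1 + X 0 : MvPolynomial (Fin 2) ℚ)

/-- `ψ5_apply`: auxiliary theorem of the arctan-fibre calculus for `RationalCubePiKernelSingle` (stmt-26322) — see the module docstring; verbatim from the lens file. -/
theorem ψ5_apply (w : Fin 2 → ℝ) : ψ5 w = (2 * w 1 + w 0 - 1) / (w 1 + w 0) := by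
  simp [ψ5]

/-- `π5`: `[A_hi] ≡ [reflect₁ p₀]` by the fibred chart `u = (2x+y−1)/(x+y)` (`∂u/∂x = (1+y)/(x+y)²`,
`1 + (1−u)² = Q_A/(x+y)²`). -/
theorem AHi_p0 : KZ.of AHi - KZ.of (reflect 1 p0).rep ∈ KZ.relations := by
  have hden : ∀ z ∈ bandHi, 0 < z 1 + z 0 := fun z hz => by
    obtain ⟨⟨hy0, -⟩, hx0, -⟩ := mem_bandHi.mp hz
    linarith
  refine KZ.of_sub_of_mem_relations_of_fibreMap (G := KZ.cube 1) (a := fA) (b := fun _ => (1 : ℝ))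
    (a' := fun _ => (0 : ℝ)) (b' := fun _ => (1 : ℝ)) ψ5 (fun w => (1 + w 0) / (w 1 + w 0) ^ 2)
    AHi (reflect 1 p0).rep rfl (cube_succ_eq_band 1) (fun y hy => ?_) ?_ (fun z hz => ?_)
    (fun z hz => ?_) (fun z hz => ?_) (fun y hy => ?_) (fun y hy => ?_) (fun z hz => ?_)
  · have := (mem_cube_one_iff.mp hy).1
    rw [fA_apply]; linarith
  · exact isSemialgebraicFunOn_aeval_div_aeval AHi.isSemialgebraic_domain _ _ fun z hz => by
      have h := hden z hz
      have e : aeval z (X 1 + X 0 : MvPolynomial (Fin 2) ℚ) = z 1 + z 0 := by simp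
      rw [e]; exact h.ne'
  · have h := hden z hz
    have hd : aeval z (X 1 + X 0 : MvPolynomial (Fin 2) ℚ) ≠ 0 := by
      have e : aeval z (X 1 + X 0 : MvPolynomial (Fin 2) ℚ) = z 1 + z 0 := by simp
      rw [e]; exact h.ne'
    exact ((Literature.ModelTheory.ExponentialFields.analyticOnNhd_aeval
        (2 * X 1 + X 0 - 1 : MvPolynomial (Fin 2) ℚ) z (mem_univ z)).div
      (Literature.ModelTheory.ExponentialFields.analyticOnNhd_aeval
        (X 1 + X 0 : MvPolynomial (Fin 2) ℚ) z (mem_univ z)) hd).differentiableAt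
  · have h := hden z hz
    have hfun : (fun t : ℝ => ψ5 (Fin.snoc (Fin.init z) t)) = fun t => (2 * t + z 0 - 1) / (t + z 0) := by
      funext t
      rw [snoc_init_eq, ψ5_apply, vec_zero, vec_one]
    rw [hfun]
    have hd := ((((hasDerivAt_id (z 1)).const_mul 2).add_const (z 0)).sub_const 1).div
      ((hasDerivAt_id (z 1)).add_const (z 0)) h.ne'
    refine hd.congr_deriv ?_
    simp only [id]
    rw [div_left_inj' (pow_ne_zero 2 h.ne')]
    ring
  · have h := hden z hz
    obtain ⟨⟨hy0, -⟩, -, -⟩ := mem_bandHi.mp hz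
    exact div_pos (by linarith) (pow_pos h 2)
  · rw [ψ5_apply, snoc_two_zero, snoc_two_one, fA_apply]
    ring
  · have := (mem_cube_one_iff.mp hy).1
    have h : (1 : ℝ) + y 0 ≠ 0 := by linarith
    rw [ψ5_apply, snoc_two_zero, snoc_two_one, div_eq_one_iff_eq h]
    ring
  · have hs := hden z hz
    obtain ⟨⟨hy0, hy1⟩, hlo, hx1⟩ := mem_bandHi.mp hz
    have hx0 : (0 : ℝ) ≤ z 1 := by linarith
    have hy1' : (0 : ℝ) ≤ 1 - z 0 := by linarith
    have hx1' : (0 : ℝ) ≤ 1 - z 1 := by linarith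
    have hQ := cA_pos (show z ∈ KZ.cube 2 from bandHi_sub hz)
    show cA.fn z = (reflect 1 p0).fn (Fin.snoc (Fin.init z) (ψ5 z)) * ((1 + z 0) / (z 1 + z 0) ^ 2)
    rw [snoc_init_eq, fn_reflect_one, vec_zero, vec_one, p0_fn, vec_zero, vec_one, cA_fn, ψ5_apply]
    field_simp
    ring

/-- `π7`: `[A_lo] ≡ [A_lo°]` (dropping the null face `y = 1`). -/
theorem ALo_ALoO : KZ.of ALo - KZ.of ALoO ∈ KZ.relations := by
  refine KZ.of_sub_of_mem_relations_of_null ALo ALoO ?_ ?_ (fun _ _ => rfl)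
  · refine measure_mono_null (fun z hz => ?_) (volume_setOf_zero_eq 1)
    have h1 : z ∈ bandLo := hz.1
    have h2 : z ∉ bandLoO := hz.2
    obtain ⟨⟨hy0, hy1⟩, hx0, hx1⟩ := mem_bandLo.mp h1
    by_contra hne
    exact h2 (mem_bandLoO.mpr ⟨⟨hy0, lt_of_le_of_ne hy1 hne⟩, hx0, hx1⟩)
  · have h : ALoO.domain \ ALo.domain = ∅ := sdiff_eq_empty.mpr bandLoO_sub_bandLo
    rw [h, measure_empty]

/-- The chart of the lower piece: `u = x(1+y)²/((1−y)(1+y²−(1−y)x))`. -/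
def ψ8 : (Fin 2 → ℝ) → ℝ := fun w =>
  aeval w (X 1 * (1 + X 0) ^ 2 : MvPolynomial (Fin 2) ℚ) /
    aeval w ((1 - X 0) * (1 + X 0 ^ 2 - (1 - X 0) * X 1) : MvPolynomial (Fin 2) ℚ)

/-- `ψ8_apply`: auxiliary theorem of the arctan-fibre calculus for `RationalCubePiKernelSingle` (stmt-26322) — see the module docstring; verbatim from the lens file. -/
theorem ψ8_apply (w : Fin 2 → ℝ) :
    ψ8 w = w 1 * (1 + w 0) ^ 2 / ((1 - w 0) * (1 + w 0 ^ 2 - (1 - w 0) * w 1)) := by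
  simp [ψ8]

end Dissection

end Summit.KontsevichZagierPeriods.RootDecompRationalCubeDichotomy.ArctanFibre

end
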